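import Literature.AlgebraicGeometry.HodgeTheory.VHSDataDualChart
import Literature.AlgebraicGeometry.Motives.FamiliesVHSTensorPower
import Literature.AlgebraicGeometry.Motives.FamiliesVHSHom
import HarnessLib

/-!
# Charted variations: CDK Theorem 1.1 (`r = 1`) for every tensor construction `T^{a,b}D = D^{⊗a} ⊗ (D^∨)^{⊗b}` from the charts of `D`

Topic `Literature/AlgebraicGeometry/HodgeTheory` (namespace `Literature.AlgebraicGeometry.Motives.VHSData[.IsCharted]`), lane `lit-hodgefound` (seat `p08`,
row g58-#6); the assembly of `VHSDataPunctureChart` (`PunctureChart`, `⊗`), `VHSDataInteriorChart` (`InteriorChart`, `⊗`, Thm 1.1 from charts),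
`VHSDataChartTateTwistConstant` (`cast`, Tate twists, constant variations), `VHSDataDualChart` (`D^∨`) with `Motives/FamiliesVHSTensorPower`
(`D^{⊗m}`, `T^{a,b}D`).  ONE DEFINITION WITH BODY — the `Prop`-valued predicate **`VHSData.IsCharted D ψ σ`** (a structure of two existential
clauses) — and THEOREMS; no named fact, no instance, no notation (D-0026 net debt `0`).

PRINTED SOURCE, VERBATIM.  E. Cattani, P. Deligne, A. Kaplan, *On the locus of Hodge classes*, J. AMS 8 (1995), p. 483: «Let `S` be a complex algebraic
variety and `{𝒱_s}` a polarizable variation of Hodge structure of weight `0` on `S` with polarization form `Q`. […] THEOREM 1.1. For `u ∈ 𝒱` integral of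
type `(0,0)` at `s`, with `Q(u, u) ≤ K`, the locus where `u` remains of type `(0,0)` is algebraic […] COROLLARY 1.2: `S^{(K)}` is an algebraic variety,
finite over `S`»; p. 484: the reductions to weight `0` («replacing `𝒱` by `𝒱 ⊗ 𝒱^*` or by `End 𝒱`»), to `S` a curve, and §2 (pp. 487–489): near each
puncture «the pullback of the local system `𝒱_ℤ` can be trivialized» ((2.4)), the nilpotent orbit and the holomorphic gauge `Φ(z) = exp(zN)·exp Γ(s)·F`
((2.7)).  For a curve `S` and rank `r = 1` the tree proves Thm 1.1 ∕ Cor 1.2 from LOCAL PERIOD CHARTS (interior: holomorphic lifts of the period map on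
coordinate discs; at the punctures: Schmid's nilpotent orbit theorem) — `hodgeLocusOfNormLe_eq_univ_or_finite_of_local ∕ _of_charts`.  THIS FILE packages
«`D` admits such charts on the discs `ψ a` and along the ends `σ i`» as `IsCharted D ψ σ` and proves that it PROPAGATES TO ALL TENSOR CONSTRUCTIONS, so that
**Theorem 1.1 holds for `D₁ ⊗ D₂`, `D(j)`, `D^∨`, `D^{⊗m}` and every `T^{a,b}D` as soon as `D` (resp. `D₁`, `D₂`) is charted** — the Hodge loci of
tensors (P. Deligne, *Hodge cycles on abelian varieties*, LNM 900, I §3: the spaces `T^{m,n} = V^{⊗m} ⊗ (V^∨)^{⊗n}` and their Hodge classes).  Along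
isometric isomorphisms of VHS data the loci themselves are transported (`Iso.hodgeLocusOfNormLe_tensorSpace_eq`, `Motives/FamiliesVHSIsometryDual`).

CONTENT.
* §1 **`IsCharted D ψ σ`** (`∀ a, ∃ V H₀ P₀, Nonempty (D.InteriorChart (ψ a) P₀)` and `∀ i, ∃ V L, Nonempty (D.PunctureChart (σ i) L)`, the reference
  spaces quantified existentially in `Type`), `IsCharted.of_charts`.
* §2 closure: **`IsCharted.tensor`**, `cast`, `tateTwist`, **`dual`**, `const ∕ tate ∕ unit` (discs with preconnected targets), **`tensorPow`**
  (induction on `D^{⊗0} = ℤ_S`, `D^{⊗(m+1)} = D^{⊗m} ⊗ D`), **`tensorSpace`**, **`hom`** (`Hom(D₁, D₂) = D₁^∨ ⊗ D₂`).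
* §3 **`IsCharted.hodgeLocusOfNormLe_eq_univ_or_finite`** (Thm 1.1 ∕ Cor 1.2, `r = 1`, for a charted variation over a preconnected `S` covered by
  the discs, with open ends beyond heights `A i` and a compact core) and `…_of_compactification` (punctured compact curve).
* §4 **`hodgeLocusOfNormLe_tensorSpace_eq_univ_or_finite(_of_compactification)`**, `hodgeLocusOfNormLe_tensorPow_eq_univ_or_finite`,
  **`hodgeLocusOfNormLe_hom_eq_univ_or_finite`**: CDK THEOREM 1.1 FOR EVERY `T^{a,b}D`, `D^{⊗m}` OF A CHARTED `D` AND FOR THE MORPHISM ∕ ENDOMORPHISM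
  LOCUS `Hom(D₁, D₂)`, `End(D)`.

HONEST SCOPE.  `IsCharted` is a HYPOTHESIS on the datum `D : VHSData S k` (which records neither holomorphy nor Griffiths transversality): that an
honest polarized `ℤ`VHS over a curve with unipotent local monodromies is charted in this sense is Schmid's nilpotent orbit theorem plus the holomorphy of
the period map, not formalised here; rank `r ≥ 2` (CDK Thm 2.16 in general), `dim S ≥ 2` and the exterior powers `⋀^r D` are not treated.

## References

* [CattaniDeligneKaplan1995] E. Cattani, P. Deligne, A. Kaplan, *On the locus of Hodge classes*, J. Amer. Math. Soc. 8 (1995), §1 (pp. 483–484),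
  Thm. 1.1, Cor. 1.2, Thm. 1.5 (p. 485), 2.3 (p. 487), (2.4) (p. 488), 2.7 (p. 489).
* [Deligne1982HodgeCycles] P. Deligne, *Hodge cycles on abelian varieties*, LNM 900 (1982), I §3, 3.1–3.4, Prop. 3.6.
* [DeligneMilne1982] P. Deligne, J. Milne, *Tannakian categories*, LNM 900 (1982), §1, 1.5–1.6 (iterated tensor products).
* [CattaniElZeinGriffithsLe2014] E. Cattani et al. (eds.), *Hodge Theory* (2014), Def. 8.3.6, §8.3.2.4.
* [DeligneHodgeII1971] P. Deligne, *Théorie de Hodge II*, 2.1.13–2.1.14.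
* [CarlsonMullerStachPeters2017] J. Carlson, S. Müller-Stach, C. Peters, *Period Mappings and Period Domains*, 2nd ed. (2017), §15.3.
* [Schmid1973] W. Schmid, *Variation of Hodge structure*, Invent. Math. 22 (1973), §2, (4.9)–(4.12) (cite only).
* [Deligne1970] P. Deligne, *Équations différentielles à points singuliers réguliers*, LNM 163 (1970), I.1 (`Hom = dual ⊗`).
* [KlinglerOtwinowskaUrbanik2023] B. Klingler, A. Otwinowska, D. Urbanik, *On the fields of definition of Hodge loci*, Ann. Sci. ÉNS (2023), §1.1 (context).
-/

noncomputable section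

open scoped TensorProduct
open _root_.Topology _root_.Filter Set

namespace Literature.AlgebraicGeometry.Motives.VHSData

open HodgeTheory

variable {S : Type} [TopologicalSpace S] {k k' k₁ k₂ : ℤ}
variable {α ι : Type*} (ψ : α → OpenPartialHomeomorph S ℂ) (σ : ι → ℂ → S)

/-! ## §1 Charted variations -/

/-- **`D` is CHARTED** with respect to a family of coordinate discs `ψ a` and of ends `σ i : ℋ → S`: on every disc `ψ a` there is an interior local period
chart of `D` (for SOME finite-dimensional reference space and polarized reference Hodge structure), and along every end `σ i` a local period chart at
the puncture (for SOME reference space and polarized limit mixed Hodge structure) — the standing local hypotheses of Cattani–Deligne–Kaplan §1–§2 for a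
polarized `ℤ`-variation over a curve (Schmid's nilpotent orbit theorem at the punctures, holomorphic local lifts of the period map inside), packaged
existentially so that they propagate to the tensor constructions. [cite: CattaniDeligneKaplan1995, §1 (pp. 483–484), (2.4) (p. 488), 2.7 (p. 489)]
[cite: Schmid1973, §2 and (4.9)–(4.12) (cite only)] -/
structure IsCharted (D : VHSData S k) : Prop where
  /-- an interior chart on each coordinate disc -/
  interior : ∀ a, ∃ (V : Type) (_ : AddCommGroup V) (_ : Module ℚ V) (_ : FiniteDimensional ℚ V) (H₀ : HodgeStructure V k) (P₀ : H₀.Polarization),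
    Nonempty (D.InteriorChart (ψ a) P₀)
  /-- a puncture chart along each end -/
  puncture : ∀ i, ∃ (V : Type) (_ : AddCommGroup V) (_ : Module ℚ V) (_ : FiniteDimensional ℚ V) (L : PolarizedLimitMixedHodgeStructure V k),
    Nonempty (D.PunctureChart (σ i) L)

namespace IsCharted

variable {ψ σ}

/-- Charts with a common reference space give `IsCharted`. [cite: CattaniDeligneKaplan1995, §1 (pp. 483–484)] -/
theorem of_charts {D : VHSData S k} {V : Type} [AddCommGroup V] [Module ℚ V] [FiniteDimensional ℚ V] {H₀ : α → HodgeStructure V k}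
    {P₀ : ∀ a, (H₀ a).Polarization} (Ci : ∀ a, D.InteriorChart (ψ a) (P₀ a)) {L : ι → PolarizedLimitMixedHodgeStructure V k}
    (Cp : ∀ i, D.PunctureChart (σ i) (L i)) : D.IsCharted ψ σ :=
  ⟨fun a => ⟨V, inferInstance, inferInstance, inferInstance, H₀ a, P₀ a, ⟨Ci a⟩⟩, fun i => ⟨V, inferInstance, inferInstance, inferInstance, L i, ⟨Cp i⟩⟩⟩

/-! ## §2 Charted variations are closed under the tensor constructions -/

/-- **`D₁, D₂` charted ⟹ `D₁ ⊗ D₂` charted** (same discs and ends: `InteriorChart.tensor`, `PunctureChart.tensor`).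
[cite: CattaniDeligneKaplan1995, §1 (pp. 483–484)] [cite: CattaniElZeinGriffithsLe2014, Def. 8.3.6 and §8.3.2.4] -/
theorem tensor {D₁ : VHSData S k₁} {D₂ : VHSData S k₂} (h₁ : D₁.IsCharted ψ σ) (h₂ : D₂.IsCharted ψ σ) : (D₁.tensor D₂).IsCharted ψ σ := by
  haveI : HodgeTensorFacts.{0, 0} := hodgeTensorFacts_holds
  refine ⟨fun a => ?_, fun i => ?_⟩
  · obtain ⟨V₁, _, _, _, H₁, P₁, ⟨C₁⟩⟩ := h₁.interior a
    obtain ⟨V₂, _, _, _, H₂, P₂, ⟨C₂⟩⟩ := h₂.interior a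
    exact ⟨V₁ ⊗[ℚ] V₂, inferInstance, inferInstance, inferInstance, H₁.tensor H₂, P₁.tensor P₂, ⟨C₁.tensor C₂⟩⟩
  · obtain ⟨V₁, _, _, _, L₁, ⟨C₁⟩⟩ := h₁.puncture i
    obtain ⟨V₂, _, _, _, L₂, ⟨C₂⟩⟩ := h₂.puncture i
    exact ⟨V₁ ⊗[ℚ] V₂, inferInstance, inferInstance, inferInstance, L₁.tensor L₂, ⟨C₁.tensor C₂⟩⟩

/-- `D` charted ⟹ `D.cast h` charted. [cite: CattaniDeligneKaplan1995, §1 (pp. 483–484)] -/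
theorem cast {D : VHSData S k} (h : D.IsCharted ψ σ) (e : k = k') : (D.cast e).IsCharted ψ σ := by
  refine ⟨fun a => ?_, fun i => ?_⟩
  · obtain ⟨V, _, _, _, H₀, P₀, ⟨C⟩⟩ := h.interior a
    exact ⟨V, inferInstance, inferInstance, inferInstance, _, P₀.cast e, ⟨C.cast e⟩⟩
  · obtain ⟨V, _, _, _, L, ⟨C⟩⟩ := h.puncture i
    exact ⟨V, inferInstance, inferInstance, inferInstance, L.cast e, ⟨C.cast e⟩⟩

/-- `D` charted ⟹ `D(j)` charted. [cite: DeligneHodgeII1971, 2.1.14] [cite: CattaniDeligneKaplan1995, §1 (pp. 483–484)] -/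
theorem tateTwist {D : VHSData S k} (h : D.IsCharted ψ σ) (j : ℤ) : (D.tateTwist j).IsCharted ψ σ := by
  refine ⟨fun a => ?_, fun i => ?_⟩
  · obtain ⟨V, _, _, _, H₀, P₀, ⟨C⟩⟩ := h.interior a
    exact ⟨V, inferInstance, inferInstance, inferInstance, _, P₀.tateTwist j, ⟨C.tateTwist j⟩⟩
  · obtain ⟨V, _, _, _, L, ⟨C⟩⟩ := h.puncture i
    exact ⟨V, inferInstance, inferInstance, inferInstance, L.tateTwist j, ⟨C.tateTwist j⟩⟩

/-- **`D` charted ⟹ `D^∨` charted** (`InteriorChart.dual`, `PunctureChart.dual`: same reference space, twisted reference structures, `Q`-dual lattice).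
[cite: CattaniDeligneKaplan1995, §1 (pp. 483–484)] [cite: Deligne1982HodgeCycles, I Prop. 3.6 (proof)] -/
theorem dual {D : VHSData S k} (h : D.IsCharted ψ σ) : D.dual.IsCharted ψ σ := by
  refine ⟨fun a => ?_, fun i => ?_⟩
  · obtain ⟨V, _, _, _, H₀, P₀, ⟨C⟩⟩ := h.interior a
    exact ⟨V, inferInstance, inferInstance, inferInstance, _, _, ⟨C.dual⟩⟩
  · obtain ⟨V, _, _, _, L, ⟨C⟩⟩ := h.puncture i
    exact ⟨V, inferInstance, inferInstance, inferInstance, _, ⟨C.dual⟩⟩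

/-- **Constant variations are charted** on discs with preconnected targets (`InteriorChart.const`, `PunctureChart.const`).
[cite: CattaniDeligneKaplan1995, (2.4), 2.7 (pp. 488–489)] [cite: CarlsonMullerStachPeters2017, §15.3] -/
theorem const (hψ : ∀ a, IsPreconnected (ψ a).target) {M : Type} [AddCommGroup M] [Module.Finite ℤ M] [Module.Free ℤ M] {V : Type} [AddCommGroup V]
    [Module ℚ V] [FiniteDimensional ℚ V] {ι' : M →ₗ[ℤ] V} (hι : IsBaseChange ℚ ι') {n : ℤ} {H : HodgeStructure V n} (Q : H.Polarization) :
    (VHSData.const S hι Q).IsCharted ψ σ :=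
  of_charts (fun a => InteriorChart.const S hι Q (ψ a) (hψ a)) fun i => PunctureChart.const S hι Q (σ i)

/-- The Tate variation `ℤ_S(j)` is charted. [cite: DeligneHodgeII1971, 2.1.13] [cite: CattaniDeligneKaplan1995, (2.4) (p. 488)] -/
theorem tate (hψ : ∀ a, IsPreconnected (ψ a).target) (j : ℤ) : (VHSData.tate S j).IsCharted ψ σ :=
  of_charts (fun a => InteriorChart.tate S j (ψ a) (hψ a)) fun i => PunctureChart.tate S j (σ i)

/-- The unit variation `ℤ_S` is charted. [cite: DeligneHodgeII1971, 2.1.13] [cite: CattaniDeligneKaplan1995, (2.4) (p. 488)] -/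
theorem unit (hψ : ∀ a, IsPreconnected (ψ a).target) : (VHSData.unit S).IsCharted ψ σ :=
  of_charts (fun a => InteriorChart.unit S (ψ a) (hψ a)) fun i => PunctureChart.unit S (σ i)

/-- **`D` charted ⟹ every tensor power `D^{⊗m}` charted** (`D^{⊗0} = ℤ_S`, `D^{⊗(m+1)} = D^{⊗m} ⊗ D`).
[cite: CattaniDeligneKaplan1995, §1 (pp. 483–484)] [cite: DeligneMilne1982, §1, 1.5–1.6] -/
theorem tensorPow {D : VHSData S k} (h : D.IsCharted ψ σ) (hψ : ∀ a, IsPreconnected (ψ a).target) :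
    ∀ m : ℕ, (D.tensorPow m).IsCharted ψ σ
  | 0 => (unit hψ).cast _
  | m + 1 => ((tensorPow h hψ m).tensor h).cast _

/-- **`D` charted ⟹ every mixed tensor space `T^{a,b}D = D^{⊗a} ⊗ (D^∨)^{⊗b}` charted.** [cite: CattaniDeligneKaplan1995, §1 (pp. 483–484)]
[cite: Deligne1982HodgeCycles, I §3, 3.1–3.4] -/
theorem tensorSpace {D : VHSData S k} (h : D.IsCharted ψ σ) (hψ : ∀ a, IsPreconnected (ψ a).target) (a b : ℕ) :
    (D.tensorSpace a b).IsCharted ψ σ :=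
  (h.tensorPow hψ a).tensor (h.dual.tensorPow hψ b)

/-- **`D₁, D₂` charted ⟹ `Hom(D₁, D₂) = D₁^∨ ⊗ D₂` charted** (in particular `End(D) = Hom(D, D)`). [cite: CattaniDeligneKaplan1995, §1 (p. 484: «replacing `𝒱` by
`𝒱 ⊗ 𝒱^*` or by `End 𝒱`»)] [cite: Deligne1970, I.1] -/
theorem hom {D₁ : VHSData S k₁} {D₂ : VHSData S k₂} (h₁ : D₁.IsCharted ψ σ) (h₂ : D₂.IsCharted ψ σ) : (D₁.hom D₂).IsCharted ψ σ :=
  (h₁.dual.tensor h₂).cast _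

/-! ## §3 Theorem 1.1 (`r = 1`) for a charted variation -/

/-- **CDK THEOREM 1.1 / COROLLARY 1.2 (`r = 1`) FOR A CHARTED VARIATION.**  `S` preconnected and covered by the discs `ψ a`; along each end `σ i`
a height `A i` beyond which `σ i` maps `{Im z > A'}` onto open sets and off which a compact core remains.  Then for `p + p = k` and every `K`:
**`{s | ∃ u ∈ V_ℤ,s ∖ 0 integral of type (p,p), Q(u,u) ≤ K}` is ALL of `S` or FINITE.** [cite: CattaniDeligneKaplan1995, Thm. 1.1, Cor. 1.2 (p. 484), Thm. 1.5 and «1.5 ⟹ 1.1» (p. 485)] -/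
theorem hodgeLocusOfNormLe_eq_univ_or_finite [PreconnectedSpace S] {D : VHSData S k} (h : D.IsCharted ψ σ) {p : ℤ} (hpk : p + p = k) (K : ℤ)
    (hcov : ∀ x : S, ∃ a, x ∈ (ψ a).source) (A : ι → ℝ) (hopen : ∀ (i : ι) (A' : ℝ), A i ≤ A' → IsOpen (σ i '' {z : ℂ | A' < z.im}))
    (hcore : ∀ A' : ι → ℝ, (∀ i, A i ≤ A' i) → ∃ K₀ : Set S, IsCompact K₀ ∧ K₀ ∪ ⋃ i, σ i '' {z : ℂ | A' i < z.im} = univ) :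
    D.hodgeLocusOfNormLe p K = univ ∨ (D.hodgeLocusOfNormLe p K).Finite := by
  refine D.hodgeLocusOfNormLe_eq_univ_or_finite_of_local p K (fun x => ?_) σ A hopen hcore fun i => ?_
  · obtain ⟨a, hx⟩ := hcov x
    obtain ⟨V, _, _, _, H₀, P₀, ⟨C⟩⟩ := h.interior a
    exact C.mem_nhds_or_eventually_not_mem hpk K hx
  · obtain ⟨V, _, _, _, L, ⟨C⟩⟩ := h.puncture i
    obtain ⟨A₁, -, -, hA⟩ := C.forall_mem_hodgeLocusOfNormLe_or_forall_not_mem hpk K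
    refine ⟨max A₁ (A i), le_max_right _ _, ?_⟩
    rcases hA with hall | hnone
    · exact Or.inl fun z hz => hall z ((le_max_left _ _).trans hz)
    · exact Or.inr fun z hz => hnone z ((le_max_left _ _).trans hz)

variable {X : Type*} [TopologicalSpace X] [CompactSpace X]

/-- **THEOREM 1.1 / COROLLARY 1.2 FOR A CHARTED VARIATION OVER A PUNCTURED COMPACT CURVE**: the ends and the core from a compactification `j : S ↪ X`
with `X ∖ j(S) ⊆ {pt i}`, disc charts `φ i` at the punctures containing the ball of radius `e^{−2πA_i}`, uniformised by `σ i` beyond height `A i`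
(`j(σ i z) = (φ i)⁻¹(e^{2πiz})`). [cite: CattaniDeligneKaplan1995, Thm. 1.1, Cor. 1.2 (p. 484), 2.3 (p. 487)] -/
theorem hodgeLocusOfNormLe_eq_univ_or_finite_of_compactification [PreconnectedSpace S] {D : VHSData S k} (h : D.IsCharted ψ σ) {p : ℤ}
    (hpk : p + p = k) (K : ℤ) (hcov : ∀ x : S, ∃ a, x ∈ (ψ a).source) (A : ι → ℝ)
    {j : S → X} (hj : IsEmbedding j) (pt : ι → X) (hpS : ∀ i, pt i ∉ range j) (hcovX : ∀ x : X, x ∉ range j → ∃ i, x = pt i)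
    (φ : ι → OpenPartialHomeomorph X ℂ) (hp : ∀ i, pt i ∈ (φ i).source) (hφp : ∀ i, φ i (pt i) = 0)
    (hball : ∀ i, Metric.ball (0 : ℂ) (Real.exp (-(2 * Real.pi * A i))) ⊆ (φ i).target)
    (hσ : ∀ (i : ι) (z : ℂ), A i < z.im → j (σ i z) = (φ i).symm (Complex.exp (2 * Real.pi * Complex.I * z))) :
    D.hodgeLocusOfNormLe p K = univ ∨ (D.hodgeLocusOfNormLe p K).Finite :=
  h.hodgeLocusOfNormLe_eq_univ_or_finite hpk K hcov A (Literature.Topology.isOpen_image_ends hj φ A hball σ hσ)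
    (Literature.Topology.exists_isCompact_core hj pt hpS hcovX φ hp hφp A hball σ hσ)

/-! ## §4 CDK Theorem 1.1 for ALL the tensor constructions `T^{a,b}D`, `D^{⊗m}`, `Hom(D₁, D₂)` from charts of the factors -/

/-- **CDK THEOREM 1.1 / COROLLARY 1.2 FOR EVERY MIXED TENSOR SPACE `T^{a,b}D = D^{⊗a} ⊗ (D^∨)^{⊗b}` OF A CHARTED VARIATION** (the «tensorial» Hodge
loci of the Mumford–Tate / monodromy literature): for `p + p = a·k + b·(−k)` and every `K`, **the set of `s ∈ S` carrying a nonzero integral tensor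
of type `(p, p)` in `T^{a,b}V_ℤ,s` with `Q(u, u) ≤ K` is ALL of `S` or FINITE.** [cite: CattaniDeligneKaplan1995, §1 (pp. 483–484), Thm. 1.1, Cor. 1.2]
[cite: Deligne1982HodgeCycles, I §3, 3.1–3.4] [cite: KlinglerOtwinowskaUrbanik2023, §1.1 (context)] -/
theorem hodgeLocusOfNormLe_tensorSpace_eq_univ_or_finite [PreconnectedSpace S] {D : VHSData S k} (h : D.IsCharted ψ σ)
    (hψ : ∀ a, IsPreconnected (ψ a).target) (a b : ℕ) {p : ℤ} (hpk : p + p = (a : ℤ) * k + (b : ℤ) * (-k)) (K : ℤ)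
    (hcov : ∀ x : S, ∃ a, x ∈ (ψ a).source) (A : ι → ℝ) (hopen : ∀ (i : ι) (A' : ℝ), A i ≤ A' → IsOpen (σ i '' {z : ℂ | A' < z.im}))
    (hcore : ∀ A' : ι → ℝ, (∀ i, A i ≤ A' i) → ∃ K₀ : Set S, IsCompact K₀ ∧ K₀ ∪ ⋃ i, σ i '' {z : ℂ | A' i < z.im} = univ) :
    (D.tensorSpace a b).hodgeLocusOfNormLe p K = univ ∨ ((D.tensorSpace a b).hodgeLocusOfNormLe p K).Finite :=
  (h.tensorSpace hψ a b).hodgeLocusOfNormLe_eq_univ_or_finite hpk K hcov A hopen hcore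

/-- **CDK THEOREM 1.1 FOR THE TENSOR POWERS `D^{⊗m}` of a charted variation.** [cite: CattaniDeligneKaplan1995, Thm. 1.1, Cor. 1.2 (p. 484)] [cite: DeligneMilne1982, §1, 1.5–1.6] -/
theorem hodgeLocusOfNormLe_tensorPow_eq_univ_or_finite [PreconnectedSpace S] {D : VHSData S k} (h : D.IsCharted ψ σ)
    (hψ : ∀ a, IsPreconnected (ψ a).target) (m : ℕ) {p : ℤ} (hpk : p + p = (m : ℤ) * k) (K : ℤ) (hcov : ∀ x : S, ∃ a, x ∈ (ψ a).source)
    (A : ι → ℝ) (hopen : ∀ (i : ι) (A' : ℝ), A i ≤ A' → IsOpen (σ i '' {z : ℂ | A' < z.im}))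
    (hcore : ∀ A' : ι → ℝ, (∀ i, A i ≤ A' i) → ∃ K₀ : Set S, IsCompact K₀ ∧ K₀ ∪ ⋃ i, σ i '' {z : ℂ | A' i < z.im} = univ) :
    (D.tensorPow m).hodgeLocusOfNormLe p K = univ ∨ ((D.tensorPow m).hodgeLocusOfNormLe p K).Finite :=
  (h.tensorPow hψ m).hodgeLocusOfNormLe_eq_univ_or_finite hpk K hcov A hopen hcore

/-- **CDK THEOREM 1.1 FOR THE MORPHISM LOCUS**: for charted `D₁`, `D₂` (same discs and ends) and `p + p = k₂ − k₁`, the set of `s ∈ S` carrying a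
nonzero integral element of `Hom(V₁,ℤ, V₂,ℤ)_s = (V₁,ℤ^∨ ⊗ V₂,ℤ)_s` of type `(p, p)` (for `p = 0`, `k₁ = k₂`: a MORPHISM OF HODGE STRUCTURES `V₁,s → V₂,s`)
with `Q(u, u) ≤ K` is ALL of `S` or FINITE; `D₁ = D₂`: the locus of extra endomorphisms ∕ Hodge tensors in `End(V_ℤ)`.
[cite: CattaniDeligneKaplan1995, §1 (p. 484), Thm. 1.1, Cor. 1.2] [cite: Deligne1982HodgeCycles, I §3, 3.1–3.4] -/
theorem hodgeLocusOfNormLe_hom_eq_univ_or_finite [PreconnectedSpace S] {D₁ : VHSData S k₁} {D₂ : VHSData S k₂} (h₁ : D₁.IsCharted ψ σ)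
    (h₂ : D₂.IsCharted ψ σ) {p : ℤ} (hpk : p + p = k₂ - k₁) (K : ℤ) (hcov : ∀ x : S, ∃ a, x ∈ (ψ a).source) (A : ι → ℝ)
    (hopen : ∀ (i : ι) (A' : ℝ), A i ≤ A' → IsOpen (σ i '' {z : ℂ | A' < z.im}))
    (hcore : ∀ A' : ι → ℝ, (∀ i, A i ≤ A' i) → ∃ K₀ : Set S, IsCompact K₀ ∧ K₀ ∪ ⋃ i, σ i '' {z : ℂ | A' i < z.im} = univ) :
    (D₁.hom D₂).hodgeLocusOfNormLe p K = univ ∨ ((D₁.hom D₂).hodgeLocusOfNormLe p K).Finite :=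
  (h₁.hom h₂).hodgeLocusOfNormLe_eq_univ_or_finite hpk K hcov A hopen hcore

/-- **CDK THEOREM 1.1 FOR EVERY `T^{a,b}D` OVER A PUNCTURED COMPACT CURVE.** [cite: CattaniDeligneKaplan1995, Thm. 1.1, Cor. 1.2 (p. 484), 2.3 (p. 487)]
[cite: Deligne1982HodgeCycles, I §3, 3.1–3.4] -/
theorem hodgeLocusOfNormLe_tensorSpace_eq_univ_or_finite_of_compactification [PreconnectedSpace S] {D : VHSData S k} (h : D.IsCharted ψ σ)
    (hψ : ∀ a, IsPreconnected (ψ a).target) (a b : ℕ) {p : ℤ} (hpk : p + p = (a : ℤ) * k + (b : ℤ) * (-k)) (K : ℤ)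
    (hcov : ∀ x : S, ∃ a, x ∈ (ψ a).source) (A : ι → ℝ)
    {j : S → X} (hj : IsEmbedding j) (pt : ι → X) (hpS : ∀ i, pt i ∉ range j) (hcovX : ∀ x : X, x ∉ range j → ∃ i, x = pt i)
    (φ : ι → OpenPartialHomeomorph X ℂ) (hp : ∀ i, pt i ∈ (φ i).source) (hφp : ∀ i, φ i (pt i) = 0)
    (hball : ∀ i, Metric.ball (0 : ℂ) (Real.exp (-(2 * Real.pi * A i))) ⊆ (φ i).target)
    (hσ : ∀ (i : ι) (z : ℂ), A i < z.im → j (σ i z) = (φ i).symm (Complex.exp (2 * Real.pi * Complex.I * z))) :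
    (D.tensorSpace a b).hodgeLocusOfNormLe p K = univ ∨ ((D.tensorSpace a b).hodgeLocusOfNormLe p K).Finite :=
  (h.tensorSpace hψ a b).hodgeLocusOfNormLe_eq_univ_or_finite_of_compactification hpk K hcov A hj pt hpS hcovX φ hp hφp hball hσ

end IsCharted

end Literature.AlgebraicGeometry.Motives.VHSData

end
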